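import Literature.Computability.Cryptography.RegevVerificationTest
import HarnessLib

/-!
# Regev 2009, Lemma 3.6 with an approximately evaluated statistic (what a machine computes)

Topic `Computability/Cryptography` (family `pqc`), grouping namespace `Regev2009`; sequel of
`RegevVerificationTest.lean` (Regev's verification test with the exact statistic `cos(2π·residual/(qK))`
on fine samples, its means and Hoeffding bounds). Everything here is PROVED; the definitions
(`testStat`, `acceptSetStat`) have bodies; no named fact.

A polynomial-time machine cannot evaluate `cos(2πk/(qK))` exactly; it evaluates some function
`g : ℤ_{qK} → ℝ` (a rational rounding of the cosine, say) with `|g(k) - cos(2πk/(qK))| ≤ η` and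
`|g| ≤ B`, and runs the SAME test: accept the candidate `s'` iff `∑ⱼ g(bⱼ - kmul⟨aⱼ, s'⟩) ≥ Nθ`. This
file proves that Lemma 3.6 survives with the means moved by at most `η`:

* `testStat g s'`, `acceptSetStat g N θ s'` — the statistic and acceptance event for a general readout
  `g` of the residual (`testStat (Re ∘ e^{2πi·/(qK)}) = testCos`, `testStat_re_toCircle`);
* `abs_tsum_lweSampleK_testStat_sub_le` — **the means**: under `A^{(K)}_{s,χ}`,
  `|E[testStat g s'] - (cosMean χ if s' = s, else 0)| ≤ η`;
* `toReal_acceptStat_of_ne_le` (`s' ≠ s`, `θ ≥ η`: `Pr[accept] ≤ exp(-N(θ-η)²/(8B²))`),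
  `toReal_rejectStat_self_le` (`θ ≤ cosMean χ - η`: `Pr[reject s] ≤ exp(-N(cosMean χ - η - θ)²/(8B²))`);
* the instance used by a machine: `|g| ≤ 1`, `η ≤ e^{-πα²}/8`, `χ = Ψ̄^{(qK)}_β` with `|β| ≤ α`,
  `4πe^{πα²} ≤ qK`, threshold `θ_α = e^{-πα²}/2`: `Pr[accept s' ≠ s] ≤ exp(-N e^{-2πα²}/64)`
  (`toReal_acceptStat_of_ne_le_exp`) and `Pr[reject s] ≤ exp(-N e^{-2πα²}/512)`
  (`toReal_rejectStat_self_le_exp`) — the `(η_A, η_R)` a machine feeds to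
  `Regev2009.toReal_firstAccepted_ne_le_grid` / `regevBDD` / `Peikert2009.regevBDD_solves_eventually_of_test`.

## References

* O. Regev, *On lattices, learning with errors, random linear codes, and cryptography*, J. ACM 56
  (2009), art. 34 = arXiv:2401.03703, Lemma 3.6 and its proof [RegevLWE2009].
* W. Hoeffding, *Probability inequalities for sums of bounded random variables*, JASA 58 (1963), Thm. 2
  [Hoeffding1963].
-/

noncomputable section

open MeasureTheory ProbabilityTheory Complex Finset
open scoped Real ENNReal NNReal

namespace Literature.Computability.Cryptography

namespace Regev2009

open Literature.Probability.Distributions Literature.Probability.Moments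

section Stat

variable {ι : Type} [Fintype ι] [DecidableEq ι] (q K : ℕ) [NeZero q] [NeZero K]

/-- LOCAL GLUE. A general readout `g` of the residual `b - kmul⟨a, s'⟩ ∈ ℤ_{qK}` of a fine sample
against the candidate `s'` (a machine's rounded cosine; Regev's exact statistic is
`g = Re ∘ e^{2πi·/(qK)}`). [cite: RegevLWE2009, Lemma 3.6 (proof: "`z := (1/n)∑cos(2πyᵢ)`")] -/
def testStat (g : ZMod (q * K) → ℝ) (s' : ι → ZMod q) (x : (ι → ZMod q) × ZMod (q * K)) : ℝ :=
  g (x.2 - kmul q K (x.1 ⬝ᵥ s'))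

omit [DecidableEq ι] in
/-- Regev's exact statistic is the readout `Re ∘ e^{2πi·/(qK)}`. [folklore] -/
theorem testStat_re_toCircle (s' : ι → ZMod q) :
    testStat q K (fun k => ((ZMod.toCircle k : Circle) : ℂ).re) s' = testCos q K s' := rfl

/-- **The means move by at most `η`.** If `|g(k) - cos(2πk/(qK))| ≤ η` and `|g| ≤ B`, then under
`A^{(K)}_{s,χ}`: `|E[testStat g s'] - (cosMean χ if s' = s else 0)| ≤ η` (the exact means are those of
`tsum_lweSampleK_testCos`; the difference is the expectation of a function bounded by `η`).
[cite: RegevLWE2009, Lemma 3.6 (proof)] -/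
theorem abs_tsum_lweSampleK_testStat_sub_le (χ : PMF (ZMod (q * K))) (s s' : ι → ZMod q)
    {g : ZMod (q * K) → ℝ} {η B : ℝ} (hg : ∀ k, |g k - ((ZMod.toCircle k : Circle) : ℂ).re| ≤ η)
    (hB : ∀ k, |g k| ≤ B) :
    |∑' x, (lweSampleK q K χ s x).toReal * testStat q K g s' x - (if s' = s then cosMean χ else 0)| ≤ η := by
  rw [← tsum_lweSampleK_testCos q K χ s s']
  have hs1 : Summable fun x => (lweSampleK q K χ s x).toReal * testStat q K g s' x :=
    PMF.summable_toReal_mul_of_bounded _ (f := testStat q K g s') fun x => hB _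
  have hs2 : Summable fun x => (lweSampleK q K χ s x).toReal * testCos q K s' x :=
    PMF.summable_toReal_mul_of_bounded _ (abs_testCos_le_one q K s')
  rw [← hs1.tsum_sub hs2]
  simp_rw [← mul_sub]
  exact PMF.abs_tsum_toReal_mul_le _ fun x => hg _

/-- LOCAL GLUE. The acceptance event of the test with readout `g` and threshold `θ` on the empirical
mean: `∑ⱼ g(residualⱼ) ≥ Nθ`. [cite: RegevLWE2009, Lemma 3.6 (proof)] -/
def acceptSetStat (g : ZMod (q * K) → ℝ) (N : ℕ) (θ : ℝ) (s' : ι → ZMod q) :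
    Set (Fin N → (ι → ZMod q) × ZMod (q * K)) :=
  {y | (N : ℝ) * θ ≤ ∑ j, testStat q K g s' (y j)}

/-- **Wrong candidate**: for `s' ≠ s`, `θ ≥ η`, `|g - cos| ≤ η`, `|g| ≤ B` (`B > 0`):
`Pr[accept] ≤ exp(-N(θ - η)²/(8B²))` on `N` independent samples from `A^{(K)}_{s,χ}` (mean `≤ η`,
Hoeffding). [cite: RegevLWE2009, Lemma 3.6 (proof)] -/
theorem toReal_acceptStat_of_ne_le (χ : PMF (ZMod (q * K))) {s s' : ι → ZMod q} (h : s' ≠ s) (N : ℕ)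
    {g : ZMod (q * K) → ℝ} {η B θ : ℝ} (hg : ∀ k, |g k - ((ZMod.toCircle k : Circle) : ℂ).re| ≤ η)
    (hB0 : 0 < B) (hB : ∀ k, |g k| ≤ B) (hθ : η ≤ θ) :
    ((LWE.iidPMF (lweSampleK q K χ s) N).toOuterMeasure (acceptSetStat q K g N θ s')).toReal ≤
      Real.exp (-((N : ℝ) * (θ - η) ^ 2 / (8 * B ^ 2))) := by
  have hm := abs_tsum_lweSampleK_testStat_sub_le q K χ s s' hg hB
  rw [if_neg h, sub_zero, tsum_fintype] at hm
  have hmean : ∀ j : Fin N, ∑ x, ((fun _ => lweSampleK q K χ s) j x).toReal * testStat q K g s' x ≤ η :=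
    fun j => (le_abs_self _).trans hm
  have hmain := toReal_toOuterMeasure_indepLaw_sum_ge_mul_le (fun _ : Fin N => lweSampleK q K χ s)
    (testStat q K g s') hB0 (fun x => hB _) hmean hθ
  rw [LWE.indepLaw_const] at hmain
  exact hmain

/-- **Right candidate**: for `θ ≤ cosMean χ - η`, `|g - cos| ≤ η`, `|g| ≤ B` (`B > 0`):
`Pr[reject s] ≤ exp(-N(cosMean χ - η - θ)²/(8B²))`. [cite: RegevLWE2009, Lemma 3.6 (proof)] -/
theorem toReal_rejectStat_self_le (χ : PMF (ZMod (q * K))) (s : ι → ZMod q) (N : ℕ)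
    {g : ZMod (q * K) → ℝ} {η B θ : ℝ} (hg : ∀ k, |g k - ((ZMod.toCircle k : Circle) : ℂ).re| ≤ η)
    (hB0 : 0 < B) (hB : ∀ k, |g k| ≤ B) (hθ : θ ≤ cosMean χ - η) :
    ((LWE.iidPMF (lweSampleK q K χ s) N).toOuterMeasure (acceptSetStat q K g N θ s)ᶜ).toReal ≤
      Real.exp (-((N : ℝ) * (cosMean χ - η - θ) ^ 2 / (8 * B ^ 2))) := by
  have hm := abs_tsum_lweSampleK_testStat_sub_le q K χ s s hg hB
  rw [if_pos rfl, tsum_fintype] at hm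
  have hmean : ∀ j : Fin N, cosMean χ - η ≤ ∑ x, ((fun _ => lweSampleK q K χ s) j x).toReal * testStat q K g s x :=
    fun j => by have := (abs_sub_le_iff.1 hm).2; linarith
  have hmain := toReal_toOuterMeasure_indepLaw_sum_lt_mul_le (fun _ : Fin N => lweSampleK q K χ s)
    (testStat q K g s) hB0 (fun x => hB _) hmean hθ
  rw [LWE.indepLaw_const] at hmain
  have hset : (acceptSetStat q K g N θ s)ᶜ = {y | ∑ j, testStat q K g s (y j) < (N : ℝ) * θ} := by
    ext y
    simp only [acceptSetStat, Set.mem_compl_iff, Set.mem_setOf_eq, not_le]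
  rw [hset]
  exact hmain

/-! ### The instance a machine uses: `|g| ≤ 1`, `η ≤ e^{-πα²}/8`, threshold `θ_α` -/

/-- **Wrong candidate, concrete form**: readout `η`-close to the cosine with `η ≤ e^{-πα²}/8`, `|g| ≤ 1`,
threshold `θ_α = e^{-πα²}/2`: `Pr[accept s' ≠ s] ≤ exp(-N e^{-2πα²}/64)`. [cite: RegevLWE2009, Lemma 3.6] -/
theorem toReal_acceptStat_of_ne_le_exp (χ : PMF (ZMod (q * K))) (α : ℝ) {s s' : ι → ZMod q} (h : s' ≠ s)
    (N : ℕ) {g : ZMod (q * K) → ℝ} {η : ℝ} (hg : ∀ k, |g k - ((ZMod.toCircle k : Circle) : ℂ).re| ≤ η)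
    (hB : ∀ k, |g k| ≤ 1) (hη : η ≤ Real.exp (-(π * α ^ 2)) / 8) :
    ((LWE.iidPMF (lweSampleK q K χ s) N).toOuterMeasure (acceptSetStat q K g N (threshold α) s')).toReal ≤
      Real.exp (-((N : ℝ) * Real.exp (-(2 * π * α ^ 2)) / 64)) := by
  have hθ : η ≤ threshold α := by unfold threshold; have := Real.exp_pos (-(π * α ^ 2)); linarith
  refine (toReal_acceptStat_of_ne_le q K χ h N hg one_pos hB hθ).trans ?_
  rw [Real.exp_le_exp, neg_le_neg_iff, one_pow, mul_one]
  have hgap : 3 * Real.exp (-(π * α ^ 2)) / 8 ≤ threshold α - η := by unfold threshold; linarith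
  have hg0 : 0 ≤ 3 * Real.exp (-(π * α ^ 2)) / 8 := by positivity
  have hsq := pow_le_pow_left₀ hg0 hgap 2
  have hexp : Real.exp (-(2 * π * α ^ 2)) = Real.exp (-(π * α ^ 2)) ^ 2 := by
    rw [← Real.exp_nat_mul]; push_cast; ring_nf
  have hN : (0 : ℝ) ≤ N := Nat.cast_nonneg _
  rw [hexp]
  calc (N : ℝ) * Real.exp (-(π * α ^ 2)) ^ 2 / 64 ≤ (N : ℝ) * (3 * Real.exp (-(π * α ^ 2)) / 8) ^ 2 / 8 := by
        nlinarith [sq_nonneg (Real.exp (-(π * α ^ 2)))]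
    _ ≤ (N : ℝ) * (threshold α - η) ^ 2 / 8 := by gcongr

/-- **Right candidate, concrete form**: readout `η`-close to the cosine with `η ≤ e^{-πα²}/8`, `|g| ≤ 1`,
`χ = Ψ̄^{(qK)}_β` with `|β| ≤ α`, `4πe^{πα²} ≤ qK`, threshold `θ_α`:
`Pr[reject s] ≤ exp(-N e^{-2πα²}/512)`. [cite: RegevLWE2009, Lemma 3.6] -/
theorem toReal_rejectStat_self_le_exp {α β : ℝ} (hβ : |β| ≤ α) (hQ : 4 * π * Real.exp (π * α ^ 2) ≤ (q * K : ℕ))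
    (s : ι → ZMod q) (N : ℕ) {g : ZMod (q * K) → ℝ} {η : ℝ}
    (hg : ∀ k, |g k - ((ZMod.toCircle k : Circle) : ℂ).re| ≤ η) (hB : ∀ k, |g k| ≤ 1)
    (hη : η ≤ Real.exp (-(π * α ^ 2)) / 8) :
    ((LWE.iidPMF (lweSampleK q K (LWE.discretizedGaussian (q * K) β) s) N).toOuterMeasure
        (acceptSetStat q K g N (threshold α) s)ᶜ).toReal ≤
      Real.exp (-((N : ℝ) * Real.exp (-(2 * π * α ^ 2)) / 512)) := by
  have hgap0 := gap_le_cosMean_sub_threshold hβ hQ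
  have hgap : Real.exp (-(π * α ^ 2)) / 8 ≤
      cosMean (LWE.discretizedGaussian (q * K) β) - η - threshold α := by linarith
  have hθ : threshold α ≤ cosMean (LWE.discretizedGaussian (q * K) β) - η := by
    have := Real.exp_pos (-(π * α ^ 2)); linarith
  refine (toReal_rejectStat_self_le q K _ s N hg one_pos hB hθ).trans ?_
  rw [Real.exp_le_exp, neg_le_neg_iff, one_pow, mul_one]
  have hg0 : 0 ≤ Real.exp (-(π * α ^ 2)) / 8 := by positivity
  have hsq := pow_le_pow_left₀ hg0 hgap 2
  have hexp : Real.exp (-(2 * π * α ^ 2)) = Real.exp (-(π * α ^ 2)) ^ 2 := by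
    rw [← Real.exp_nat_mul]; push_cast; ring_nf
  have hN : (0 : ℝ) ≤ N := Nat.cast_nonneg _
  rw [hexp]
  calc (N : ℝ) * Real.exp (-(π * α ^ 2)) ^ 2 / 512 = (N : ℝ) * (Real.exp (-(π * α ^ 2)) / 8) ^ 2 / 8 := by ring
    _ ≤ (N : ℝ) * (cosMean (LWE.discretizedGaussian (q * K) β) - η - threshold α) ^ 2 / 8 := by gcongr

end Stat

end Regev2009

end Literature.Computability.Cryptography
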